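import Summits.QuantumFields.BalabanUV.Beta.FP.RoadLeftAssemblyLetters
import Summits.QuantumFields.BalabanUV.Beta.FP.RoadEndLeftUndressed
import Summits.QuantumFields.BalabanUV.Beta.FP.PerfectJetLetters
import Summits.QuantumFields.BalabanUV.Beta.FP.RoadLeftLiteralSwap

/-!
# `BalabanUV.Beta.FP.RoadLeftLiteralRowsLetters` — road «FP» for binder row D1: THE END DOWN TO FINITE-`j` ROWS WITH THE W-SPLIT LETTERS RE-WIRED, AT THE LITERAL
# (leaf-01's `RoadLeftAssemblyLetters.d1Drift_left_of_sliceLedger_rows_letters` AT `Js := JsB12Sym hOdd Ncol tabs cΛ cB`; offer O-g11-6, leaf-01 «NOT MINE — GO» journal l.29862)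

HONEST DEPENDENCY (page 1, mandatory): continuum YM on T⁴ ⇐ BetaPertH ∧ nine spine estimates (0/9 proved); BetaPertH ⇐ (D1) ∧ (D4) ∧ CAP+tail;
G-an2-4 gates asym, D1 and NE2/3/4.  HONEST FRAMING (cell contract, verbatim): «discharging `BetaPertH` makes Bałaban's UV stability UNCONDITIONAL —
a real constructive-QFT result; it is NOT the continuum limit and NOT the Clay problem.»  THIS MODULE is [our object] COMPOSITION BY NAME (leaf-01's
`d1Drift_left_of_sliceLedger_rows_letters`, `PerfectJetLetters.sPerf_letters_of_rows`; this lineage's `RoadEndLeftUndressed` §2 +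
`JsB12Sym_S_translate_pow_one`; leaf-01's `RoadLeftLiteralSwap.hTj_JsB12Sym`); no `def`, no `def … : Prop`, nothing cited, 0 sorry.  AT THE LITERAL: (a) the four (CONV-C) S∕W rows are asked of the
UNDRESSED unit-rescaled jets of `JsB12Sym0`; (c) `hSp` is supplied from DISPLAYED X1m-S rows with the raw members' covariance DISCHARGED at `m = 1` and displayed for
`m ≥ 2` (our families); **`hTj` DISCHARGED by leaf-01's `RoadLeftLiteralSwap.hTj_JsB12Sym`**;
everything else VERBATIM (X1m-W rows, `hWj` — an2's K-R5 lane —, `hSDF` — the shared crux —, the W-split #14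
letters `hsplit` ∕ `hWf` ∕ `hWx` ∕ `hextra` ((G8)∕(G-mix-W)), PART 3b's 13 classes); `hWinf hloc₀ hlocx hs₀ hsx` are discharged INSIDE
leaf-01's END.  DISPLAYED = nothing of Bałaban's asserted.  0∕4 row-D1 binders; NOT (CONV-C), NOT X1, NOT hWj, NOT SDF, NOT hslice, NOT (ASYMP),
NOT D1, NOT BetaPertH, NOT continuum, NOT Clay.  «not in print; our bookkeeping».
ABSOLUTE RULE (cell charter, verbatim): «No internally-minted statement may enter as a cited fact. Every hypothesis is either kernel-proved in this package or a
verbatim quotation of a PUBLISHED theorem with page reference. The manuscript(s) under audit are NOT citable for their own disputed steps — they are the thing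
under adjudication; programme-internal (2001/route/tribunal) claims are never citable.»
CONTENT: [our object] **`d1Drift_JsB12Sym_of_sliceLedger_rows_letters`** (d = 3, `2 ≤ Lc`, `Odd Lc`, adopted units, `μ ≠ ν`) — conclusion `D1Drift Lc (JsB12Sym hOdd Ncol tabs cΛ cB) N μ ν`.
The `m = 1` member of the displayed `hsplit` is `RoadLeftLiteral.wPerf_one_split_JsB12Sym_of_rates` at `Wf 1 := S₂∞`, `Wx 1 := X∞`.
Provenance: D1 formalisation swarm LEAF PROVER 06, unit b2b-balaban-beta-d1-formalise-leaf-06 gen 11, 2026-08-21.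
-/

noncomputable section

namespace Summit.QuantumFields.BalabanUV.Beta.FP.RoadLeftLiteralRowsLetters

open Finset
open scoped BigOperators
open Literature.MathematicalPhysics.QuantumFieldTheory.Balaban1983to89
open Literature.MathematicalPhysics.QuantumFieldTheory.Balaban1983to89.Beta
open Literature.MathematicalPhysics.QuantumFieldTheory.Balaban1983to89.Beta.BubbleTransfer (c4)
open Literature.MathematicalPhysics.QuantumFieldTheory.Balaban1983to89.B12Normalization (stepBal)
open B12Sec2to5 (l1 l1_nonneg)
open PolarizationSign (AxisReflectionCovariant reflSign)
open ExpKernelCalculus (Site MKer BiLoc comp shiftK tr tadpole bubble Zl Zl_nonneg)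
open KernelWard (Bdd divV divW)
open KernelReflection (LegMap refK bondRefl tadpole_smul bubble_smul_left bubble_smul_right)
open StepJetData (biLoc_smul)
open OneStepResolventKernel (Fib LocStencil)
open OneStepKernelFamily (flipK colH)
open DyadicShell (Pt supNorm)
open LeadingCoefficient (kappaBal)
open AxialProjector (coProj)
open AxialDressing (axDressK)
open SecondOrderResponse (vertex2OfK)
open Summit.QuantumFields.BalabanUV.Beta.GAN24.CombesThomas (sfStep smStep)
open Summit.QuantumFields.BalabanUV.Beta.D1BFx.MomentTransferPeriodicEntry (EKer₂ dressedEntryP)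
open Summit.QuantumFields.BalabanUV.Beta.D1BFx.ReducedKernelSandwichLeg (fineHessA fineHessA_apply)
open Summit.QuantumFields.BalabanUV.Beta.D1BFx.DressedTablesLeg (tadpoleTableA_apply bubbleTableA_apply)
open Summit.QuantumFields.BalabanUV.Beta.D1BFx.PackedKernelSplit (inj blk biLoc_blk)
open Summit.QuantumFields.BalabanUV.Beta.D1BFx.ContactCount (abs_comp_le_of_entryBound abs_comp_le_of_rightLoc abs_tr_le_of_rightLoc
  abs_tadpole_le_of_entryBound abs_bubble_le_of_entryBound)
open Summit.QuantumFields.BalabanUV.Beta.FP.PerfectObjectsT (KPerf TPerfOf)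
open Summit.QuantumFields.BalabanUV.Beta.FP.WilsonCubicGerm (cubicGermOf)
open Summit.QuantumFields.BalabanUV.Beta.FP.GhostCubicGerm (cubicGermOfSc)
open Summit.QuantumFields.BalabanUV.Beta.FP.BubbleGermValue (bfGerm ghostGerm)
open Summit.QuantumFields.BalabanUV.Beta.FP.PerfectPolarization (Pker G0ker PiBF)
open Summit.QuantumFields.BalabanUV.Beta.FP.PerfectPolarizationWard (bdd_Pker)
open Summit.QuantumFields.BalabanUV.Beta.FP.FineHessianGluonCore (fineHessA_gluonCore fineHessA_Pker_eq_ff bdd_smul)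
open Summit.QuantumFields.BalabanUV.Beta.FP.FineHessianTransportTable (PiBF_eq_fineHessA)
open Summit.QuantumFields.BalabanUV.Beta.FP.FineHessianNearLedgerGen (hasym_PiBF_of_sliceLedger_gen)

open Summit.QuantumFields.BalabanUV.Beta.FP.FineHessianNearLedgerCore (abs_ite_le bdd_blk nearSplit_of_slice bounded_seven)
open DecimatedMomentSummable (ConstReproSum LinReproSum)
open Summit.QuantumFields.BalabanUV.Beta.FP.TransportInfinityM (colOf)

open SecondOrderResponse (vertex2OfK)
open OneStepKernelFamily (vertexOfK)
open ExpKernelCalculus (hessKer Decays)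
open Summit.QuantumFields.BalabanUV.Beta.FP.PerfectColumnTransportTail (transportLetters_perfCol)
open Summit.QuantumFields.BalabanUV.Beta.FP.PerfectColumnSharp (abs_colOf_KPerf_le_sharp)
open Summit.QuantumFields.BalabanUV.Beta.FP.StepLawKHolds (exists_decays_KPerf_holds)
open Summit.QuantumFields.BalabanUV.Beta.FP.SymmetryK (shiftK_KPerf)
open Summit.QuantumFields.BalabanUV.Beta.FP.GenericResolventSandwich (hessKer_self_eq_dressedEntryP)
open Summit.QuantumFields.BalabanUV.Beta.FP.FineSplitJunctionNearFar (exists_bound_fineHessA)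
open OneStepResolventKernel (JetData)
open OneStepKernelFamily (D1Drift)
open ExpKernelCalculus (VertexFamily₂)
open Summit.QuantumFields.BalabanUV.Beta.HessKerDressedUnits (unitS unitW)
open Summit.QuantumFields.BalabanUV.Beta.TameKernelCalculus (Loc)
open Summit.QuantumFields.BalabanUV.Beta.FP.PerfectObjects (KTot)
open Summit.QuantumFields.BalabanUV.Beta.FP.PerfectObjectsT (SPerfOf WPerfOf)
open Summit.QuantumFields.BalabanUV.Beta.FP.RoadEndGeneric (fPerfG)
open Summit.QuantumFields.BalabanUV.Beta.FP.RoadEndLeft (d1Drift_left_of_step_law_wslot_split)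
open Summit.QuantumFields.BalabanUV.Beta.FP.RoadAsympEndLeft (hasym_PiBF_of_sliceLedger_left)
open Summit.QuantumFields.BalabanUV.Beta.FP.RoadLeftAssemblySDF (d1Drift_left_of_sliceLedger_sdf)
open Summit.QuantumFields.BalabanUV.Beta.FP.SymmetryInheritGeneric (wardTransversal_flipK_TGenOf_one_of_wardRow swap_TGenOf_one_of_swapRow)
open Summit.QuantumFields.BalabanUV.Beta.HessKerConvCKPlug (exists_merged_rows)
open Summit.QuantumFields.BalabanUV.Beta.GAN24.CombesThomas (sfStep_ne_zero smStep_ne_zero)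
open Summit.QuantumFields.BalabanUV.Beta.GAN24.KSlotAssembly (convCKWall_holds)
open Summit.QuantumFields.BalabanUV.Beta.HessKerFourFamily (TbalOf_apply)
open HessKerDressedLimit (vertexFamily₂_limTabOf)
open OneStepKernelFamily (TbalOf)
open Summit.QuantumFields.BalabanUV.Beta.FP.StepLawLeft (stepLaw_left_of_ward_symm_explicitDefect)
open Summit.QuantumFields.BalabanUV.Beta.FP.StepDefectInherit (defect)
open Summit.QuantumFields.BalabanUV.Beta.FP.TransportInfinityM (colOf)
open DressedMomentNormalisation (dressedEntry)
open PolarizationSign (WardTransversal)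
open OneStepKernelFamily (flipK vertexOfK)
open KernelWard (biLoc_add)
open OneStepResolventKernel (biLoc_mono)
open ExpKernelCalculus (BiLoc)
open Summit.QuantumFields.BalabanUV.Beta.FP.PerfectObjectsT (KPerf)
open Summit.QuantumFields.BalabanUV.Beta.FP.BiVertexSlotLetters (vertexFamily₂_vertex2OfK_of_biLoc hloc₀_of_jetLetters hs₀_of_jetLetters
  hlocx_of_extraLetter hsx_of_extraLetter)
open AffineAveraging (toSite)
open Summit.QuantumFields.BalabanUV.Beta.SymmetrisedStepJets
open Summit.QuantumFields.BalabanUV.Beta.FP.PerfectJetLetters (sPerf_letters_of_rows)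
open Summit.QuantumFields.BalabanUV.Beta.FP.RoadEndLeftUndressed (sRow_JsB12Sym_of_undressed sRowAll_JsB12Sym_of_undressed
  wRow_JsB12Sym_of_undressed wRowAll_JsB12Sym_of_undressed JsB12Sym_S_translate_pow_one)
open Summit.QuantumFields.BalabanUV.Beta.FP.RoadLeftAssemblyLetters (d1Drift_left_of_sliceLedger_rows_letters)
open Summit.QuantumFields.BalabanUV.Beta.FP.RoadLeftLiteralSwap (hTj_JsB12Sym)

variable {Lc : ℕ} [NeZero Lc]

/-- **ROAD «FP» — THE END DOWN TO FINITE-`j` ROWS, W-SPLIT LETTERS RE-WIRED, AT THE LITERAL OF RECORD** [our object]: leaf-01's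
`d1Drift_left_of_sliceLedger_rows_letters` at
`Js := JsB12Sym hOdd Ncol tabs cΛ cB` with the (CONV-C) S∕W rows on the UNDRESSED unit jets of `JsB12Sym0`, `hSp` from X1m-S rows (`hcov 1` discharged),
`hTj` discharged by leaf-01's `hTj_JsB12Sym`, everything else verbatim.  CONCLUSION: `D1Drift Lc (JsB12Sym hOdd Ncol tabs cΛ cB) N μ ν`. -/
theorem d1Drift_JsB12Sym_of_sliceLedger_rows_letters (hLc : 2 ≤ Lc) (hOdd : Odd Lc) (Ncol : ℕ) (tabs : SymTables 3 Lc) (cΛ cB : ℝ)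
    -- the (j, m)-families of the literal's stencils ∕ second-order tables, pinned at m = 1
    (S : ℕ → ℕ → Fin (3 + 1) → (Fin (3 + 1) → ℤ) → MKer (3 + 1) (Fib 3))
    (Wt : ℕ → ℕ → Fin (3 + 1) → (Fin (3 + 1) → ℤ) → Fin (3 + 1) → (Fin (3 + 1) → ℤ) → MKer (3 + 1) (Fib 3))
    (hSt1 : ∀ j, S j 1 = (JsB12Sym hOdd Ncol tabs cΛ cB j).S) (hWt1 : ∀ j, Wt j 1 = (JsB12Sym hOdd Ncol tabs cΛ cB j).W)
    -- (CONV-C) S-slot and W-slot rows of the UNDRESSED unit-rescaled jets of `JsB12Sym0` (row G-an2-4; HYPOTHESES; the dressing is bookkeeping, `RoadEndLeftUndressed` §2)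
    {Cs0 cS δS θS Cw0 cW δW θW : ℝ}
    (hS0 : ∀ j, LocStencil (unitS (sfStep Lc j) (smStep 3 Lc j) (JsB12Sym0 hOdd Ncol tabs cΛ cB j).S) Cs0 δS)
    (hSall0 : ∀ k j, LocStencil (unitS (sfStep Lc (k + j)) (smStep 3 Lc (k + j)) (JsB12Sym0 hOdd Ncol tabs cΛ cB (k + j)).S -
      unitS (sfStep Lc k) (smStep 3 Lc k) (JsB12Sym0 hOdd Ncol tabs cΛ cB k).S) (cS * θS ^ k) δS)
    (hW0 : ∀ j, VertexFamily₂ (unitW (sfStep Lc j) (smStep 3 Lc j) (JsB12Sym0 hOdd Ncol tabs cΛ cB j).W) Lc Cw0 δW)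
    (hWall0 : ∀ k j, VertexFamily₂ (unitW (sfStep Lc (k + j)) (smStep 3 Lc (k + j)) (JsB12Sym0 hOdd Ncol tabs cΛ cB (k + j)).W -
      unitW (sfStep Lc k) (smStep 3 Lc k) (JsB12Sym0 hOdd Ncol tabs cΛ cB k).W) Lc (cW * θW ^ k) δW)
    (hδS : 0 < δS) (hδW : 0 < δW) (hθS0 : 0 ≤ θS) (hθS1 : θS < 1) (hθW0 : 0 ≤ θW) (hθW1 : θW < 1)
    -- the BF comparison data: colour weights and the admissible families (PART 3b's list starts here)
    (wg wgh : ℝ)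
    {V : Fin 4 → Site 4 → MKer 4 (Fib 3)} {W : Fin 4 → Site 4 → Fin 4 → Site 4 → MKer 4 (Fib 3)}
    {v : Fin 4 → Site 4 → MKer 4 Unit} {w : Fin 4 → Site 4 → Fin 4 → Site 4 → MKer 4 Unit} {Cv Cw Cx Cw' Cx' CwL CwL' cQ δ : ℝ} (hδ : 0 < δ)
    -- admissible-family letters, gluon sector
    (hV : ∀ (μ : Fin 4) (y : Site 4), BiLoc (V μ y) y y Cv δ) (hW : ∀ (μ : Fin 4) (y : Site 4) (ν : Fin 4) (y' : Site 4), BiLoc (W μ y ν y') y y' Cw δ)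
    (hcovV : ∀ (μ : Fin 4) (y t : Site 4), V μ (y + t) = shiftK (-t) (V μ y))
    (hcovW : ∀ (μ : Fin 4) (y : Site 4) (ν : Fin 4) (y' t : Site 4), W μ (y + t) ν (y' + t) = shiftK (-t) (W μ y ν y'))
    (X : Site 4 → MKer 4 (Fib 3)) (hX : ∀ y, BiLoc (X y) y y Cx δ)
    (hW1 : ∀ y, comp (comp Pker (divV V y)) Pker = comp Pker (X y) - comp (X y) Pker)
    (hW2 : ∀ y ν y', divW W y ν y' = comp (X y) (V ν y') - comp (V ν y') (X y))
    (hKcov : AxisReflectionCovariant (flipK (PiBF wg wgh V W v w)))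
    (h0V : ∀ (lam α β : Fin 4), ∑' p : Pt × Pt, V lam 0 p.1 p.2 (Sum.inl α) (Sum.inl β) = 0)
    (hgermV : cubicGermOf V = cQ • bfGerm)
    (hWloc : ∀ (μ ν : Fin 4) (z : Pt), BiLoc (W μ 0 ν z) 0 z (CwL * Real.exp (-δ * l1 z)) δ)
    -- admissible-family letters, ghost sector
    (hv : ∀ (μ : Fin 4) (y : Site 4), BiLoc (v μ y) y y Cv δ) (hw : ∀ (μ : Fin 4) (y : Site 4) (ν : Fin 4) (y' : Site 4), BiLoc (w μ y ν y') y y' Cw' δ)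
    (hcovv : ∀ (μ : Fin 4) (y t : Site 4), v μ (y + t) = shiftK (-t) (v μ y))
    (hcovw : ∀ (μ : Fin 4) (y : Site 4) (ν : Fin 4) (y' t : Site 4), w μ (y + t) ν (y' + t) = shiftK (-t) (w μ y ν y'))
    (Xg : Site 4 → MKer 4 Unit) (hXg : ∀ y, BiLoc (Xg y) y y Cx' δ)
    (hW1g : ∀ y, comp (comp G0ker (divV v y)) G0ker = comp G0ker (Xg y) - comp (Xg y) G0ker)
    (hW2g : ∀ y ν y', divW w y ν y' = comp (Xg y) (v ν y') - comp (v ν y') (Xg y))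
    (h0v : ∀ lam : Fin 4, ∑' p : Pt × Pt, v lam 0 p.1 p.2 () () = 0)
    (hgermv : cubicGermOfSc v = ghostGerm)
    (hwloc : ∀ (μ ν : Fin 4) (z : Pt), BiLoc (w μ 0 ν z) 0 z (CwL' * Real.exp (-δ * l1 z)) δ)
    -- the colour weights and the entry
    {N : ℝ} (hn : (40 * wg * (1 / 4 : ℝ) * (c4 * cQ) ^ 2 - wgh * (-(1 / 2 : ℝ)) * c4 ^ 2) / 3 = kappaBal N)
    {μ ν : Fin 4} (hμν : μ ≠ ν)
    -- THE LITERAL's OWN (DRESSED) perfect first-order stencils at every `m`: X1m-S rows of the unit-rescaled (j, m)-members (EXT; HYPOTHESES)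
    -- and the block covariance of the raw members for `m ≥ 2` (our (j, m)-families); at `m = 1` the covariance is DISCHARGED (`JsB12Sym_S_translate_pow_one`)
    {Csm cSm δsm θm : ℕ → ℝ}
    (hSm : ∀ m : ℕ, 1 ≤ m → ∀ j, LocStencil (unitS (sfStep Lc j) (smStep 3 Lc j) (S j m)) (Csm m) (δsm m))
    (hSmall : ∀ m : ℕ, 1 ≤ m → ∀ k j,
      LocStencil (unitS (sfStep Lc (k + j)) (smStep 3 Lc (k + j)) (S (k + j) m) - unitS (sfStep Lc k) (smStep 3 Lc k) (S k m)) (cSm m * θm m ^ k) (δsm m))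
    (hθm : ∀ m : ℕ, 1 ≤ m → θm m < 1) (hδsm : ∀ m : ℕ, 1 ≤ m → 0 < δsm m)
    (hcov2 : ∀ m : ℕ, 2 ≤ m → ∀ j κ (u t : Fin (3 + 1) → ℤ),
      S j m κ (u + ((Lc ^ m : ℕ) : ℤ) • t) = shiftK (-(((Lc ^ m : ℕ) : ℤ) • t)) (S j m κ u))
    {Wf : ℕ → Fin (3 + 1) → (Fin (3 + 1) → ℤ) → Fin (3 + 1) → (Fin (3 + 1) → ℤ) → MKer (3 + 1) (Fib 3)}
    (hWf : ∀ m : ℕ, 1 ≤ m → ∃ C2 δ2 : ℝ, 0 < δ2 ∧ (∀ κ' u l' u', BiLoc (Wf m κ' u l' u') u u' C2 δ2) ∧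
      ∀ κ' u l' u' t, Wf m κ' (u + ((Lc ^ m : ℕ) : ℤ) • t) l' (u' + ((Lc ^ m : ℕ) : ℤ) • t)
        = shiftK (-(((Lc ^ m : ℕ) : ℤ) • t)) (Wf m κ' u l' u'))
    -- the FAR LETTER of the full fine kernel (m-free shape)
    {CF af : ℝ} (hCF : 0 ≤ CF) (haf : 0 < af)
    (hfar : ∀ m : ℕ, 1 ≤ m → ∀ (c e : Fin 4) (s s' : Pt), Lc ^ m < supNorm (s' - s) →
      |fineHessA (KPerf (d := 3) Lc (sfStep Lc) (smStep 3 Lc) m) (SPerfOf (sfStep Lc) (smStep 3 Lc) S m) (Wf m) c e s s'|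
        ≤ ((Lc ^ m : ℕ) : ℝ) ^ 8 * (CF / (supNorm (s' - s) : ℝ) ^ 6 * Real.exp (-(af / ((Lc ^ m : ℕ) : ℝ)) * (supNorm (s' - s) : ℝ))))
    -- THE DISPLAYED SLICE DATA per `m`: units and bubble weight, remainder leg, slice stencils∕bi-tables, and the slice exchange `hslice`
    {c a b κ : ℕ → ℝ} (hunits₁ : ∀ m : ℕ, 1 ≤ m → (((Lc ^ m : ℕ) : ℝ) ^ 8) * wg = c m * b m)
    (hunits₂ : ∀ m : ℕ, 1 ≤ m → (((Lc ^ m : ℕ) : ℝ) ^ 8) * wg = κ m * (c m ^ 2 * a m ^ 2))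
    {R : ℕ → MKer 4 (Fin 4)} (hRb : ∀ m : ℕ, 1 ≤ m → ∃ CR, Bdd (R m) CR)
    {Ssl : ℕ → Fin 4 → Site 4 → MKer 4 (Fin 4)} (hSsl : ∀ m : ℕ, 1 ≤ m → ∃ Cs, ∀ κ u, BiLoc (Ssl m κ u) u u Cs δ)
    {Wsl : ℕ → Fin 4 → Site 4 → Fin 4 → Site 4 → MKer 4 (Fin 4)} (hWsl : ∀ m : ℕ, 1 ≤ m → ∃ C2, ∀ κ u l u', BiLoc (Wsl m κ u l u') u u' C2 δ)
    {Fmix Fgh FN : ℕ → EKer₂ 4}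
    (hslice : ∀ m : ℕ, 1 ≤ m → ∀ (c' e : Fin 4) (s s' : Pt),
      fineHessA (KPerf (d := 3) Lc (sfStep Lc) (smStep 3 Lc) m) (SPerfOf (sfStep Lc) (smStep 3 Lc) S m) (Wf m) c' e s s'
        = ((1 / 2 : ℝ) * tadpole (c m • blk Pker true true + R m) (Wsl m c' s e s')
            - (1 / 2 : ℝ) * κ m * bubble (c m • blk Pker true true + R m) (Ssl m c' s) (Ssl m e s'))
          + Fmix m c' e s s' + Fgh m c' e s s' + FN m c' e s s')
    -- THE DISPLAYED MIX SPLIT (α2-a PART 2) and GHOST SPLIT (α2-c) into bounded pieces, and the normalisation piece's bound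
    {ιM : Type*} (JM : Finset ιM) {Gmix : ιM → ℕ → EKer₂ 4}
    (hmix : ∀ m : ℕ, 1 ≤ m → ∀ (c' e : Fin 4) (s s' : Pt),
      (if supNorm (s' - s) ≤ Lc ^ m then Fmix m c' e s s' else 0) = ∑ k ∈ JM, Gmix k m c' e s s')
    (hGmix : ∀ k ∈ JM, ∀ m : ℕ, 1 ≤ m → ∀ c' e : Fin 4, ∃ A, ∀ s s', |Gmix k m c' e s s'| ≤ A)
    {ιG : Type*} (JG : Finset ιG) {Ggh : ιG → ℕ → EKer₂ 4}
    (hgh : ∀ m : ℕ, 1 ≤ m → ∀ (c' e : Fin 4) (s s' : Pt),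
      (if supNorm (s' - s) ≤ Lc ^ m then Fgh m c' e s s' + ((Lc ^ m : ℕ) : ℝ) ^ 8 * wgh * fineHessA G0ker v w c' e s s' else 0)
        = ∑ k ∈ JG, Ggh k m c' e s s')
    (hGgh : ∀ k ∈ JG, ∀ m : ℕ, 1 ≤ m → ∀ c' e : Fin 4, ∃ A, ∀ s s', |Ggh k m c' e s s'| ≤ A)
    (hFN : ∀ m : ℕ, 1 ≤ m → ∀ c' e : Fin 4, ∃ A, ∀ s s', |FN m c' e s s'| ≤ A)
    -- THE (rem) LEDGER: one number per named piece
    {B7 : Fin 7 → ℝ} {Bmix : ιM → ℝ} {Bgh : ιG → ℝ} {BN : ℝ}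
    (hL0 : ∀ m : ℕ, 1 ≤ m → ∀ S' : Finset Pt, ∑ u ∈ S', (supNorm u : ℝ) ^ 2 *
      |dressedEntryP (fun c'' a' => colH (KPerf (d := 3) Lc (sfStep Lc) (smStep 3 Lc) m) (Lc ^ m) a' 0 c'')
        (fun c' e s s' => if supNorm (s' - s) ≤ Lc ^ m then (1 / 2 : ℝ) * tadpole (R m) (Wsl m c' s e s') else 0)
        (((Lc ^ m : ℕ) : ℤ) • (-u)) μ ν| ≤ B7 0)
    (hL1 : ∀ m : ℕ, 1 ≤ m → ∀ S' : Finset Pt, ∑ u ∈ S', (supNorm u : ℝ) ^ 2 *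
      |dressedEntryP (fun c'' a' => colH (KPerf (d := 3) Lc (sfStep Lc) (smStep 3 Lc) m) (Lc ^ m) a' 0 c'')
        (fun c' e s s' => if supNorm (s' - s) ≤ Lc ^ m then
          -((1 / 2 : ℝ) * κ m) * tr (comp (comp (c m • blk Pker true true) (Ssl m c' s)) (comp (R m) (Ssl m e s'))) else 0)
        (((Lc ^ m : ℕ) : ℤ) • (-u)) μ ν| ≤ B7 1)
    (hL2 : ∀ m : ℕ, 1 ≤ m → ∀ S' : Finset Pt, ∑ u ∈ S', (supNorm u : ℝ) ^ 2 *
      |dressedEntryP (fun c'' a' => colH (KPerf (d := 3) Lc (sfStep Lc) (smStep 3 Lc) m) (Lc ^ m) a' 0 c'')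
        (fun c' e s s' => if supNorm (s' - s) ≤ Lc ^ m then
          -((1 / 2 : ℝ) * κ m) * tr (comp (comp (R m) (Ssl m c' s)) (comp (c m • blk Pker true true) (Ssl m e s'))) else 0)
        (((Lc ^ m : ℕ) : ℤ) • (-u)) μ ν| ≤ B7 2)
    (hL3 : ∀ m : ℕ, 1 ≤ m → ∀ S' : Finset Pt, ∑ u ∈ S', (supNorm u : ℝ) ^ 2 *
      |dressedEntryP (fun c'' a' => colH (KPerf (d := 3) Lc (sfStep Lc) (smStep 3 Lc) m) (Lc ^ m) a' 0 c'')
        (fun c' e s s' => if supNorm (s' - s) ≤ Lc ^ m then -((1 / 2 : ℝ) * κ m) * bubble (R m) (Ssl m c' s) (Ssl m e s') else 0)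
        (((Lc ^ m : ℕ) : ℤ) • (-u)) μ ν| ≤ B7 3)
    (hL4 : ∀ m : ℕ, 1 ≤ m → ∀ S' : Finset Pt, ∑ u ∈ S', (supNorm u : ℝ) ^ 2 *
      |dressedEntryP (fun c'' a' => colH (KPerf (d := 3) Lc (sfStep Lc) (smStep 3 Lc) m) (Lc ^ m) a' 0 c'')
        (fun c' e s s' => if supNorm (s' - s) ≤ Lc ^ m then
          (1 / 2 : ℝ) * tadpole (c m • blk Pker true true) (Wsl m c' s e s' - b m • blk (W c' s e s') true true) else 0)
        (((Lc ^ m : ℕ) : ℤ) • (-u)) μ ν| ≤ B7 4)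
    (hL5 : ∀ m : ℕ, 1 ≤ m → ∀ S' : Finset Pt, ∑ u ∈ S', (supNorm u : ℝ) ^ 2 *
      |dressedEntryP (fun c'' a' => colH (KPerf (d := 3) Lc (sfStep Lc) (smStep 3 Lc) m) (Lc ^ m) a' 0 c'')
        (fun c' e s s' => if supNorm (s' - s) ≤ Lc ^ m then
          -((1 / 2 : ℝ) * κ m) * bubble (c m • blk Pker true true) (Ssl m c' s - a m • blk (V c' s) true true) (Ssl m e s') else 0)
        (((Lc ^ m : ℕ) : ℤ) • (-u)) μ ν| ≤ B7 5)
    (hL6 : ∀ m : ℕ, 1 ≤ m → ∀ S' : Finset Pt, ∑ u ∈ S', (supNorm u : ℝ) ^ 2 *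
      |dressedEntryP (fun c'' a' => colH (KPerf (d := 3) Lc (sfStep Lc) (smStep 3 Lc) m) (Lc ^ m) a' 0 c'')
        (fun c' e s s' => if supNorm (s' - s) ≤ Lc ^ m then
          -((1 / 2 : ℝ) * κ m) * bubble (c m • blk Pker true true) (a m • blk (V c' s) true true) (Ssl m e s' - a m • blk (V e s') true true) else 0)
        (((Lc ^ m : ℕ) : ℤ) • (-u)) μ ν| ≤ B7 6)
    (hLmix : ∀ k ∈ JM, ∀ m : ℕ, 1 ≤ m → ∀ S' : Finset Pt, ∑ u ∈ S', (supNorm u : ℝ) ^ 2 *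
      |dressedEntryP (fun c'' a' => colH (KPerf (d := 3) Lc (sfStep Lc) (smStep 3 Lc) m) (Lc ^ m) a' 0 c'') (Gmix k m)
        (((Lc ^ m : ℕ) : ℤ) • (-u)) μ ν| ≤ Bmix k)
    (hLgh : ∀ k ∈ JG, ∀ m : ℕ, 1 ≤ m → ∀ S' : Finset Pt, ∑ u ∈ S', (supNorm u : ℝ) ^ 2 *
      |dressedEntryP (fun c'' a' => colH (KPerf (d := 3) Lc (sfStep Lc) (smStep 3 Lc) m) (Lc ^ m) a' 0 c'') (Ggh k m)
        (((Lc ^ m : ℕ) : ℤ) • (-u)) μ ν| ≤ Bgh k)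
    (hLN : ∀ m : ℕ, 1 ≤ m → ∀ S' : Finset Pt, ∑ u ∈ S', (supNorm u : ℝ) ^ 2 *
      |dressedEntryP (fun c'' a' => colH (KPerf (d := 3) Lc (sfStep Lc) (smStep 3 Lc) m) (Lc ^ m) a' 0 c'')
        (fun c' e s s' => if supNorm (s' - s) ≤ Lc ^ m then FN m c' e s s' else 0)
        (((Lc ^ m : ℕ) : ℤ) • (-u)) μ ν| ≤ BN)
    -- THE STEP DOOR AND THE SYMMETRY DOOR, OPENED DOWN TO FINITE-`j` ROWS (R-FP-40 (C)): the WARD and TRANSPOSITION laws of the wall's own kernels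
    -- `TbalOf Lc Js j` at EVERY `j`, and (SDF) — NO X1m-W row of the FULL (j, m)-tables (the full slot's class data follows from the W-split, §1)
    (hWj : ∀ j, WardTransversal (flipK (TbalOf Lc (JsB12Sym hOdd Ncol tabs cΛ cB) j)))
    -- `hTj` (the transposition law of `TbalOf Lc (JsB12Sym …) j`) is leaf-01's THEOREM `RoadLeftLiteralSwap.hTj_JsB12Sym` — DISCHARGED inside
    (hSDF : ∀ m : ℕ, 1 ≤ m → B12Beta.secondMoment (defect
      (fun m => hessKer (KPerf (d := 3) Lc (sfStep Lc) (smStep 3 Lc) m)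
        (vertexOfK (KPerf (d := 3) Lc (sfStep Lc) (smStep 3 Lc) m) (Lc ^ m) (SPerfOf (sfStep Lc) (smStep 3 Lc) S m)) (WPerfOf (sfStep Lc) (smStep 3 Lc) Wt m))
      (fun m a b z => ((Lc ^ m : ℕ) : ℝ) ^ 8 * dressedEntry (colOf (KPerf (d := 3) Lc (sfStep Lc) (smStep 3 Lc) m))
        (hessKer (KPerf (d := 3) Lc (sfStep Lc) (smStep 3 Lc) 1)
          (vertexOfK (KPerf (d := 3) Lc (sfStep Lc) (smStep 3 Lc) 1) Lc (SPerfOf (sfStep Lc) (smStep 3 Lc) S 1)) (WPerfOf (sfStep Lc) (smStep 3 Lc) Wt 1))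
        (((Lc ^ m : ℕ) : ℤ) • z) a b) m) μ ν = 0)
    -- the W-slot split of the perfect second-order slot (row #14): the split, ONE `VertexFamily₂` letter of the EXTRA slot `Wx m`, and the extra piece's
    -- bound ((G8)∕(G-mix-W)); `hloc₀`∕`hs₀` (bi-vertex slot) and `hlocx`∕`hsx` (extra slot) are supplied inside (`BiVertexSlotLetters` §4)
    {Wx : ℕ → Fin (3 + 1) → (Fin (3 + 1) → ℤ) → Fin (3 + 1) → (Fin (3 + 1) → ℤ) → MKer (3 + 1) (Fib 3)}
    (hsplit : ∀ m : ℕ, 1 ≤ m →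
      WPerfOf (sfStep Lc) (smStep 3 Lc) Wt m = vertex2OfK (KPerf (d := 3) Lc (sfStep Lc) (smStep 3 Lc) m) (Lc ^ m) (Wf m) + Wx m)
    (hWx : ∀ m : ℕ, 1 ≤ m → ∃ Cx δx : ℝ, 0 < δx ∧ VertexFamily₂ (Wx m) (Lc ^ m) Cx δx)
    {B : ℝ}
    (hextra : ∀ m : ℕ, 1 ≤ m →
      |B12Beta.secondMoment
          (fun μ' ν' z => (1 / 2 : ℝ) * tadpole (KPerf (d := 3) Lc (sfStep Lc) (smStep 3 Lc) m) (Wx m μ' 0 ν' z)) μ ν| ≤ B) :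
    D1Drift Lc (JsB12Sym hOdd Ncol tabs cΛ cB) N μ ν := by
  -- the covariance of the raw (j, m)-stencils: m = 1 from the tree (the dressed literal's (St)), m ≥ 2 displayed
  have hcovAll : ∀ m : ℕ, 1 ≤ m → ∀ j κ (u t : Fin (3 + 1) → ℤ),
      S j m κ (u + ((Lc ^ m : ℕ) : ℤ) • t) = shiftK (-(((Lc ^ m : ℕ) : ℤ) • t)) (S j m κ u) := by
    intro m hm j κ u t
    by_cases h1 : m = 1
    · subst h1
      rw [hSt1 j]
      exact JsB12Sym_S_translate_pow_one hOdd Ncol tabs cΛ cB j κ u t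
    · exact hcov2 m (by omega) j κ u t
  have hSp := sPerf_letters_of_rows (Lc := Lc) (sfStep Lc) (smStep 3 Lc) S hSm hSmall hθm hδsm hcovAll
  exact d1Drift_left_of_sliceLedger_rows_letters
    hLc (JsB12Sym hOdd Ncol tabs cΛ cB) S Wt hSt1 hWt1 (sRow_JsB12Sym_of_undressed hOdd Ncol tabs cΛ cB (sfStep Lc) (smStep 3 Lc) hδS.le hS0)
    (sRowAll_JsB12Sym_of_undressed hOdd Ncol tabs cΛ cB (sfStep Lc) (smStep 3 Lc) hδS hS0 hSall0) (wRow_JsB12Sym_of_undressed hOdd Ncol tabs cΛ cB (sfStep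
    Lc) (smStep 3 Lc) hδW.le hW0) (wRowAll_JsB12Sym_of_undressed hOdd Ncol tabs cΛ cB (sfStep Lc) (smStep 3 Lc) hδW hW0 hWall0) hδS hδW hθS0 hθS1 hθW0
    hθW1 wg wgh hδ hV hW hcovV hcovW X hX hW1 hW2 hKcov h0V hgermV hWloc hv hw hcovv hcovw Xg hXg hW1g hW2g h0v hgermv hwloc hn hμν hSp hWf hCF haf hfar
    hunits₁ hunits₂ hRb hSsl hWsl hslice JM hmix hGmix JG hgh hGgh hFN hL0 hL1 hL2 hL3 hL4 hL5 hL6 hLmix hLgh hLN hWj (hTj_JsB12Sym hOdd Ncol tabs cΛ cB)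
    hSDF hsplit hWx hextra

end Summit.QuantumFields.BalabanUV.Beta.FP.RoadLeftLiteralRowsLetters

end
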